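import Summits.Ventures.PercRepro.S1CoreStarPlane
import Summits.Ventures.PercRepro.S1TriangleCount
import Summits.Ventures.PercRepro.S1CoreSplit
import Summits.Ventures.PercRepro.S1CoreDelete

/-!
# PercRepro — THE STAR BOUND and LEMMA T4⁺ on the e-free core (p1, gen 21; the s₄ seat)

`proofs/P1-S4-PERPOINT.md` §4–§6. Three deletion inductions on `|E|` (the T-chain's pattern):
1. **the star bound** `2·#(4-circuits through e and x) ≤ 3ν` (`two_mul_ncard_fourCircuitsThroughPair_le`): pick a
   4-circuit `C₀` through `e, x`, let `P := cl C₀` (a plane through the line `L₀ := cl {e, x}`) and `K := P ∖ L₀`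
   (2 to 4 points). Deleting `K` keeps the core (`hfree_delete_set`), lowers the rank by at most one
   (submodularity on `(E ∖ K) ∪ P = E`, `(E ∖ K) ∩ P = L₀`), hence the nullity by at least `|K| − 1`; the 4-circuits
   through `e, x` meeting `K` lie in `P` (at most `(3|K| − 3)/2` of them, `S1CoreStarPlane`), the others are
   4-circuits of `M ＼ K`. Sharp on `U_{3,5}` (3 circuits, `ν = 2`) and on books of `U_{3,5}`-leaves on the spine.
2. **the 4-circuits through a point** `#4circ(e) ≤ perPointBound ν := Σ_{i ≤ ν} ⌊3i/2⌋` (`= 1, 4, 8, 14, 21, 30, …`;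
   `ncard_fourCircuitsThrough_le_perPointBound`): delete a second point `x` of a 4-circuit through `e` (not a
   coloop: nullity `ν − 1`); the circuits through `e, x` are bounded by 1., the others are circuits of `M ＼ {x}`.
   Corollary `four_mul_ncard_fourCircuitsThrough_le`: `4·#4circ(e) ≤ 3ν(ν + 1)`.
LEMMA T4⁺ (`s₄ ≤ Σ_{j ≤ ν} perPointBound j = 1, 5, 13, 27, 48, 78, …`, hence `4·s₄ ≤ ν(ν + 1)(ν + 2)`) is the next
module, `S1CoreFourCircuitSum`. Also `hfree_delete_set` (the core is closed under deleting any set) and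
`delete_eRk_eq_of_subset`.
Axioms: standard.
-/

open scoped Matroid

namespace PercRepro

namespace S1

open Set

variable {α : Type}


/-- `hfree` at every point survives the deletion of any set `D`. -/
theorem hfree_delete_set (M : Matroid α)
    (hfree : ∀ e ∈ M.E, ∃ A ⊆ M.E \ {e}, e ∉ M.closure A ∧ e ∉ M.closure ((M.E \ {e}) \ A)) (D : Set α) :
    ∀ e ∈ (M ＼ D).E, ∃ A ⊆ (M ＼ D).E \ {e},
      e ∉ (M ＼ D).closure A ∧ e ∉ (M ＼ D).closure (((M ＼ D).E \ {e}) \ A) := by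
  intro e he
  rw [_root_.Matroid.delete_ground] at he
  obtain ⟨A, hA, h1, h2⟩ := hfree e he.1
  refine ⟨A \ D, ?_, ?_, ?_⟩
  · rw [_root_.Matroid.delete_ground]
    intro z hz
    have := hA hz.1
    exact ⟨⟨this.1, hz.2⟩, this.2⟩
  · rw [_root_.Matroid.delete_closure_eq]
    intro h
    exact h1 (M.closure_subset_closure (sdiff_subset.trans sdiff_subset) h.1)
  · rw [_root_.Matroid.delete_closure_eq, _root_.Matroid.delete_ground]
    intro h
    refine h2 (M.closure_subset_closure ?_ h.1)
    intro z hz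
    obtain ⟨⟨⟨⟨hzE, hzD⟩, hze⟩, hzA⟩, _⟩ := hz
    exact ⟨⟨hzE, hze⟩, fun hzA' => hzA ⟨hzA', hzD⟩⟩

/-- The rank of a set avoiding `D` is unchanged in `M ＼ D`. -/
theorem delete_eRk_eq_of_subset (M : Matroid α) {D X : Set α} (hX : X ⊆ M.E \ D) :
    (M ＼ D).eRk X = M.eRk X := by
  rw [_root_.Matroid.delete_eq_restrict, _root_.Matroid.restrict_eRk_eq _ hX]

/-- **THE STAR BOUND**: on the e-free core of nullity `d`, at most `3d/2` four-circuits contain two given points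
`e ≠ x`: `2·#{C | C a 4-circuit, e ∈ C, x ∈ C} ≤ 3d`. -/
theorem two_mul_ncard_fourCircuitsThroughPair_le (M : Matroid α) [M.Finite]
    (hfree : ∀ e ∈ M.E, ∃ A ⊆ M.E \ {e}, e ∉ M.closure A ∧ e ∉ M.closure ((M.E \ {e}) \ A))
    {e x : α} (hex : e ≠ x) {d : ℕ} (hd : M.E.encard = M.eRank + d) :
    2 * {C : Set α | M.IsCircuit C ∧ C.ncard = 4 ∧ e ∈ C ∧ x ∈ C}.ncard ≤ 3 * d := by
  suffices H : ∀ n : ℕ, ∀ (M : Matroid α) [M.Finite], M.E.ncard = n →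
      (∀ e ∈ M.E, ∃ A ⊆ M.E \ {e}, e ∉ M.closure A ∧ e ∉ M.closure ((M.E \ {e}) \ A)) →
      ∀ d : ℕ, M.E.encard = M.eRank + d →
      2 * {C : Set α | M.IsCircuit C ∧ C.ncard = 4 ∧ e ∈ C ∧ x ∈ C}.ncard ≤ 3 * d from H _ M rfl hfree d hd
  intro n
  induction n using Nat.strong_induction_on with
  | _ n ih =>
  intro M _ hn hfree d hd
  classical
  set S := {C : Set α | M.IsCircuit C ∧ C.ncard = 4 ∧ e ∈ C ∧ x ∈ C} with hS
  have hSfin : S.Finite :=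
    M.ground_finite.finite_subsets.subset (fun C hC => hC.1.subset_ground)
  by_cases hSe : S = ∅
  · rw [hSe, ncard_empty]; exact Nat.zero_le _
  obtain ⟨C₀, hC₀⟩ := nonempty_iff_ne_empty.2 hSe
  have hC₀E : C₀ ⊆ M.E := hC₀.1.subset_ground
  have hC₀fin : C₀.Finite := M.ground_finite.subset hC₀E
  have heE : e ∈ M.E := hC₀E hC₀.2.2.1
  have hxE : x ∈ M.E := hC₀E hC₀.2.2.2
  have hexE : ({e, x} : Set α) ⊆ M.E := by
    intro t ht; simp only [mem_insert_iff, mem_singleton_iff] at ht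
    rcases ht with rfl | rfl; exact heE; exact hxE
  -- the plane `P := cl C₀`, the line `L₀ := cl {e, x}`, the leaf `K := P ∖ L₀`
  set P := M.closure C₀ with hPdef
  set L₀ := M.closure {e, x} with hL₀def
  set K := P \ L₀ with hKdef
  have hPE : P ⊆ M.E := M.closure_subset_ground _
  have hPfin : P.Finite := M.ground_finite.subset hPE
  have hC₀P : C₀ ⊆ P := M.subset_closure _ hC₀E
  have hrC₀ : M.eRk C₀ = 3 := by
    have h := hC₀.1.eRk_add_one_eq
    rw [← Set.Finite.cast_ncard_eq hC₀fin, hC₀.2.1] at h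
    have h' : M.eRk C₀ + 1 = (3 : ℕ∞) + 1 := by rw [h]; rfl
    exact WithTop.add_right_cancel WithTop.one_ne_top h'
  have hrP : M.eRk P ≤ 3 := by rw [hPdef, M.eRk_closure_eq, hrC₀]
  have hexC₀ : ({e, x} : Set α) ⊆ C₀ := by
    intro t ht; simp only [mem_insert_iff, mem_singleton_iff] at ht
    rcases ht with rfl | rfl; exact hC₀.2.2.1; exact hC₀.2.2.2
  have hLP : L₀ ⊆ P := M.closure_subset_closure hexC₀
  have hKE : K ⊆ M.E := sdiff_subset.trans hPE
  have hKfin : K.Finite := hPfin.subset sdiff_subset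
  have hrL₀ : M.eRk L₀ = 2 := by
    rw [hL₀def, M.eRk_closure_eq]
    have hind : M.Indep {e, x} := hC₀.1.ssubset_indep (by
      refine ⟨hexC₀, fun h => ?_⟩
      have := ncard_le_ncard h (toFinite _)
      rw [ncard_pair hex, hC₀.2.1] at this
      omega)
    rw [hind.eRk_eq_encard, ← Set.Finite.cast_ncard_eq (toFinite _), ncard_pair hex]; rfl
  -- the 4-circuits through `e, x` inside `P`
  set SP := {C : Set α | M.IsCircuit C ∧ C.ncard = 4 ∧ e ∈ C ∧ x ∈ C ∧ C ⊆ P} with hSP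
  have hSPne : SP.Nonempty := ⟨C₀, hC₀.1, hC₀.2.1, hC₀.2.2.1, hC₀.2.2.2, hC₀P⟩
  have hplane := two_mul_ncard_fourCircuits_in_plane_le M hfree hex hPE hrP hLP hSPne
  rw [← hL₀def, ← hKdef, ← hSP] at hplane
  have hK2 : 2 ≤ K.ncard := by
    have h1 := (fourCircuit_inter_closure_pair M hC₀.1 hC₀.2.1 hC₀.2.2.1 hC₀.2.2.2 hex).2
    rw [← hL₀def] at h1
    have hsub : C₀ \ L₀ ⊆ K := fun t ht => ⟨hC₀P ht.1, ht.2⟩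
    have h2 := ncard_le_ncard hsub hKfin
    omega
  -- the deleted matroid `M' := M ＼ K`
  set M' := M ＼ K with hM'
  have hfree' := hfree_delete_set M hfree K
  have hE' : M'.E = M.E \ K := _root_.Matroid.delete_ground M K
  have hE'fin : M'.E.Finite := M'.ground_finite
  have hE'card : M'.E.ncard + K.ncard = M.E.ncard := by
    rw [hE']; exact ncard_sdiff_add_ncard_of_subset hKE M.ground_finite
  have hE'lt : M'.E.ncard < n := by omega
  -- the rank drops by at most one
  have hrank : M.eRank ≤ M'.eRank + 1 := by
    have hsub := M.eRk_inter_add_eRk_union_le (M.E \ K) P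
    have hu : (M.E \ K) ∪ P = M.E := by
      apply Subset.antisymm
      · exact union_subset sdiff_subset hPE
      · intro t ht
        by_cases htK : t ∈ K
        · exact Or.inr htK.1
        · exact Or.inl ⟨ht, htK⟩
    have hi : (M.E \ K) ∩ P = L₀ := by
      ext t
      simp only [mem_inter_iff, mem_sdiff, hKdef]
      constructor
      · rintro ⟨⟨_, htK⟩, htP⟩
        by_contra htL
        exact htK ⟨htP, htL⟩
      · intro htL
        exact ⟨⟨M.closure_subset_ground _ htL, fun h => h.2 htL⟩, hLP htL⟩
    rw [hu, hi, hrL₀] at hsub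
    have hM'r : M'.eRank = M.eRk (M.E \ K) := by
      rw [_root_.Matroid.eRank_def, hE', delete_eRk_eq_of_subset M (subset_refl _)]
    rw [hM'r, _root_.Matroid.eRank_def]
    have h3 : (2 : ℕ∞) + M.eRk M.E ≤ M.eRk (M.E \ K) + 3 := hsub.trans (add_le_add (le_refl _) hrP)
    have h4 : (2 : ℕ∞) + M.eRk M.E ≤ 2 + (M.eRk (M.E \ K) + 1) := by
      refine h3.trans (le_of_eq ?_)
      rw [show (3 : ℕ∞) = 1 + 2 by norm_num]
      abel
    exact (ENat.add_le_add_iff_left (by simp)).1 h4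
  -- the nullity `d'` of `M'`
  have hν : M✶.eRank = (d : ℕ∞) := by
    have h := _root_.Matroid.eRank_add_eRank_dual M
    rw [hd] at h
    exact WithTop.add_left_cancel (PercRepro.Matroid.eRank_ne_top_of_finite M) h
  have hfin' : M'✶.eRank ≠ ⊤ := by
    intro h
    have h2 := _root_.Matroid.eRank_add_eRank_dual M'
    rw [h, add_top] at h2
    exact absurd h2.symm (hE'fin.encard_lt_top.ne)
  obtain ⟨d', hd'⟩ := ENat.ne_top_iff_exists.1 hfin'
  have hd'enc : M'.E.encard = M'.eRank + d' := by
    have h := _root_.Matroid.eRank_add_eRank_dual M'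
    rw [← hd'] at h
    exact h.symm
  -- `d' + |K| ≤ d + 1`
  have hrM : M.eRank ≠ ⊤ := PercRepro.Matroid.eRank_ne_top_of_finite M
  have hrM' : M'.eRank ≠ ⊤ := PercRepro.Matroid.eRank_ne_top_of_finite M'
  obtain ⟨r, hr⟩ := ENat.ne_top_iff_exists.1 hrM
  obtain ⟨r', hr'⟩ := ENat.ne_top_iff_exists.1 hrM'
  have hdd' : d' + K.ncard ≤ d + 1 := by
    have h1 : M.E.ncard = r + d := by
      have := hd
      rw [← hr, ← Set.Finite.cast_ncard_eq M.ground_finite] at this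
      exact_mod_cast this
    have h2 : M'.E.ncard = r' + d' := by
      have := hd'enc
      rw [← hr', ← Set.Finite.cast_ncard_eq hE'fin] at this
      exact_mod_cast this
    have h3 : r ≤ r' + 1 := by
      have := hrank
      rw [← hr, ← hr'] at this
      exact_mod_cast this
    omega
  -- split the circuits: those meeting `K` lie in `P`, the others are circuits of `M'`
  set S' := {C : Set α | M'.IsCircuit C ∧ C.ncard = 4 ∧ e ∈ C ∧ x ∈ C} with hS'
  have hsplit : S ⊆ SP ∪ S' := by
    intro C hC
    by_cases hdisj : Disjoint C K
    · exact Or.inr ⟨_root_.Matroid.delete_isCircuit_iff.2 ⟨hC.1, hdisj⟩, hC.2.1, hC.2.2.1, hC.2.2.2⟩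
    · left
      refine ⟨hC.1, hC.2.1, hC.2.2.1, hC.2.2.2, ?_⟩
      rw [Set.not_disjoint_iff] at hdisj
      obtain ⟨u, huC, huK⟩ := hdisj
      have huL : u ∉ L₀ := huK.2
      have hue : u ≠ e := fun h => huL (h ▸ M.subset_closure _ hexE (by simp))
      have hux : u ≠ x := fun h => huL (h ▸ M.subset_closure _ hexE (by simp))
      have hT : ({e, x, u} : Set α) ⊆ C := by
        intro t ht; simp only [mem_insert_iff, mem_singleton_iff] at ht
        rcases ht with rfl | rfl | rfl; exact hC.2.2.1; exact hC.2.2.2; exact huC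
      have hT3 : ({e, x, u} : Set α).ncard = 3 := ncard_eq_three.2 ⟨e, x, u, hex, hue.symm, hux.symm, rfl⟩
      have hTss : ({e, x, u} : Set α) ⊂ C := by
        refine ⟨hT, fun hCT => ?_⟩
        have := ncard_le_ncard hCT (toFinite _)
        rw [hT3, hC.2.1] at this
        omega
      have hind := hC.1.ssubset_indep hTss
      have hrT : M.eRk {e, x, u} = 3 := by
        rw [hind.eRk_eq_encard, ← Set.Finite.cast_ncard_eq (toFinite _), hT3]; rfl
      have hCfin : C.Finite := M.ground_finite.subset hC.1.subset_ground
      have hrC : M.eRk C = 3 := by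
        have h := hC.1.eRk_add_one_eq
        rw [← Set.Finite.cast_ncard_eq hCfin, hC.2.1] at h
        have h' : M.eRk C + 1 = (3 : ℕ∞) + 1 := by rw [h]; rfl
        exact WithTop.add_right_cancel WithTop.one_ne_top h'
      have hcl : M.closure {e, x, u} = M.closure C :=
        (M.isRkFinite_of_finite (toFinite _)).closure_eq_closure_of_subset_of_eRk_ge_eRk hT (by rw [hrT, hrC])
      have hTP : ({e, x, u} : Set α) ⊆ P := by
        intro t ht; simp only [mem_insert_iff, mem_singleton_iff] at ht
        rcases ht with rfl | rfl | rfl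
        · exact hC₀P hC₀.2.2.1
        · exact hC₀P hC₀.2.2.2
        · exact huK.1
      calc C ⊆ M.closure C := M.subset_closure _ hC.1.subset_ground
        _ = M.closure {e, x, u} := hcl.symm
        _ ⊆ M.closure P := M.closure_subset_closure hTP
        _ = P := by rw [hPdef, M.closure_closure]
  have hSPfin : SP.Finite := hSfin.subset (fun C hC => ⟨hC.1, hC.2.1, hC.2.2.1, hC.2.2.2.1⟩)
  have hS'fin : S'.Finite :=
    M'.ground_finite.finite_subsets.subset (fun C hC => hC.1.subset_ground)
  have h2 : 2 * S'.ncard ≤ 3 * d' := ih _ hE'lt M' rfl hfree' d' hd'enc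
  have h3 : S.ncard ≤ SP.ncard + S'.ncard :=
    (ncard_le_ncard hsplit (hSPfin.union hS'fin)).trans (ncard_union_le _ _)
  omega



/-- The per-point bound at nullity `d`, in its sharp recursive form: `Σ_{i ≤ d} ⌊3i/2⌋`
(`= 1, 4, 8, 14, 21, 30, 40, 52, 65, 80` at `d = 1 … 10`). -/
def perPointBound (d : ℕ) : ℕ := (Finset.range (d + 1)).sum (fun i => 3 * i / 2)

/-- The recursion `perPointBound (d + 1) = perPointBound d + ⌊3(d + 1)/2⌋`. -/
theorem perPointBound_succ (d : ℕ) : perPointBound (d + 1) = perPointBound d + 3 * (d + 1) / 2 := by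
  unfold perPointBound
  rw [Finset.sum_range_succ]

/-- **The 4-circuits through a point, recursive form**: `#{C | C a 4-circuit, e ∈ C} ≤ Σ_{i ≤ d} ⌊3i/2⌋` on the e-free
core of nullity `d`. Deletion induction on `|E|`: delete a second point `x` of a 4-circuit through `e` (no coloop, so
the nullity drops by one); the circuits through `e, x` number `≤ ⌊3d/2⌋` (the star bound), the others are the
4-circuits of `M ＼ {x}` through `e`. -/
theorem ncard_fourCircuitsThrough_le_perPointBound (M : Matroid α) [M.Finite]
    (hfree : ∀ e ∈ M.E, ∃ A ⊆ M.E \ {e}, e ∉ M.closure A ∧ e ∉ M.closure ((M.E \ {e}) \ A))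
    {d : ℕ} (hd : M.E.encard = M.eRank + d) (e : α) :
    {C : Set α | M.IsCircuit C ∧ C.ncard = 4 ∧ e ∈ C}.ncard ≤ perPointBound d := by
  suffices H : ∀ n : ℕ, ∀ (M : Matroid α) [M.Finite], M.E.ncard = n →
      (∀ e ∈ M.E, ∃ A ⊆ M.E \ {e}, e ∉ M.closure A ∧ e ∉ M.closure ((M.E \ {e}) \ A)) →
      ∀ d : ℕ, M.E.encard = M.eRank + d →
      {C : Set α | M.IsCircuit C ∧ C.ncard = 4 ∧ e ∈ C}.ncard ≤ perPointBound d from H _ M rfl hfree d hd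
  intro n
  induction n using Nat.strong_induction_on with
  | _ n ih =>
  intro M _ hn hfree d hd
  classical
  set S := {C : Set α | M.IsCircuit C ∧ C.ncard = 4 ∧ e ∈ C} with hS
  have hSfin : S.Finite :=
    M.ground_finite.finite_subsets.subset (fun C hC => hC.1.subset_ground)
  by_cases hSe : S = ∅
  · rw [hSe, ncard_empty]; exact Nat.zero_le _
  obtain ⟨C₀, hC₀⟩ := nonempty_iff_ne_empty.2 hSe
  have hC₀E : C₀ ⊆ M.E := hC₀.1.subset_ground
  -- a second point `x ∈ C₀`
  obtain ⟨x, hxC₀, hxe⟩ := exists_ne_of_one_lt_ncard (by rw [hC₀.2.1]; norm_num : 1 < C₀.ncard) e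
  have hxE : x ∈ M.E := hC₀E hxC₀
  -- `x` lies on a circuit, so it is not a coloop: `M ＼ {x}` has nullity `d − 1`
  have hne : ¬ M.IsColoop x := hC₀.1.not_isColoop_of_mem hxC₀
  have hν : M✶.eRank = (d : ℕ∞) := by
    have h := _root_.Matroid.eRank_add_eRank_dual M
    rw [hd] at h
    exact WithTop.add_left_cancel (PercRepro.Matroid.eRank_ne_top_of_finite M) h
  have hdel := PercRepro.Matroid.dual_eRank_delete_singleton_add_one hxE hne
  rw [hν] at hdel
  have hfin' : (M ＼ {x})✶.eRank ≠ ⊤ := by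
    intro h
    rw [h] at hdel
    exact absurd hdel (by simp)
  obtain ⟨d', hd'⟩ := ENat.ne_top_iff_exists.1 hfin'
  have hdd' : d = d' + 1 := by
    rw [← hd'] at hdel
    exact_mod_cast hdel.symm
  have hd'enc : (M ＼ {x}).E.encard = (M ＼ {x}).eRank + d' := by
    have h := _root_.Matroid.eRank_add_eRank_dual (M ＼ {x})
    rw [← hd'] at h
    exact h.symm
  have hdelE : (M ＼ {x}).E.ncard < n := by
    rw [_root_.Matroid.delete_ground, ← hn, ← ncard_sdiff_singleton_add_one hxE M.ground_finite]
    omega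
  have hfree' := hfree_delete M hfree x
  -- split the circuits through `e` by whether they contain `x`
  set S₁ := {C : Set α | M.IsCircuit C ∧ C.ncard = 4 ∧ e ∈ C ∧ x ∈ C} with hS₁
  set S₂ := {C : Set α | (M ＼ {x}).IsCircuit C ∧ C.ncard = 4 ∧ e ∈ C} with hS₂
  have hsplit : S ⊆ S₁ ∪ S₂ := by
    intro C hC
    by_cases h : x ∈ C
    · exact Or.inl ⟨hC.1, hC.2.1, hC.2.2, h⟩
    · exact Or.inr ⟨_root_.Matroid.delete_isCircuit_iff.2 ⟨hC.1, disjoint_singleton_right.2 h⟩, hC.2.1, hC.2.2⟩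
  have hS₁fin : S₁.Finite := hSfin.subset (fun C hC => ⟨hC.1, hC.2.1, hC.2.2.1⟩)
  have hS₂fin : S₂.Finite :=
    (M ＼ {x}).ground_finite.finite_subsets.subset (fun C hC => hC.1.subset_ground)
  -- the star bound and the induction hypothesis
  have h1 : 2 * S₁.ncard ≤ 3 * d := two_mul_ncard_fourCircuitsThroughPair_le M hfree hxe.symm hd
  have h1' : S₁.ncard ≤ 3 * d / 2 := (Nat.le_div_iff_mul_le (by norm_num)).2 (by linarith)
  have h2 : S₂.ncard ≤ perPointBound d' := ih _ hdelE (M ＼ {x}) rfl hfree' d' hd'enc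
  have h3 : S.ncard ≤ S₁.ncard + S₂.ncard :=
    (ncard_le_ncard hsplit (hS₁fin.union hS₂fin)).trans (ncard_union_le _ _)
  subst hdd'
  rw [perPointBound_succ]
  omega

/-- `4·Σ_{i ≤ d} ⌊3i/2⌋ ≤ 3d(d + 1)`. -/
theorem four_mul_perPointBound_le (d : ℕ) : 4 * perPointBound d ≤ 3 * d * (d + 1) := by
  induction d with
  | zero => simp [perPointBound]
  | succ k ih =>
    rw [perPointBound_succ]
    have : 4 * (3 * (k + 1) / 2) ≤ 6 * (k + 1) := by
      have := Nat.div_mul_le_self (3 * (k + 1)) 2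
      omega
    nlinarith

/-- **The 4-circuits through a point, quadratic form**: `4·#{C | C a 4-circuit, e ∈ C} ≤ 3d(d + 1)` on the e-free
core of nullity `d` (a corollary of the recursive form). -/
theorem four_mul_ncard_fourCircuitsThrough_le (M : Matroid α) [M.Finite]
    (hfree : ∀ e ∈ M.E, ∃ A ⊆ M.E \ {e}, e ∉ M.closure A ∧ e ∉ M.closure ((M.E \ {e}) \ A))
    {d : ℕ} (hd : M.E.encard = M.eRank + d) (e : α) :
    4 * {C : Set α | M.IsCircuit C ∧ C.ncard = 4 ∧ e ∈ C}.ncard ≤ 3 * d * (d + 1) :=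
  (Nat.mul_le_mul_left 4 (ncard_fourCircuitsThrough_le_perPointBound M hfree hd e)).trans
    (four_mul_perPointBound_le d)

end S1

end PercRepro
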